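/-
Copyright (c) 2026. All rights reserved.
Released under Apache 2.0 license as described in the file LICENSE.
Authors: abc-iut cell, F lane seat abc-iut-f-073 (gen 6; KEY INST59H2), over the statements of abc-iut-L4 lineage
(`ArithmeticLineBundles.lean`) and the discharge `AddLineBundleAutIsRootOfUnity_holds` (`ArithmeticLineBundlesProofs.lean`).
-/
import Literature.AnabelianGeometry.AbsoluteAnabelian.ArithmeticLineBundlesProofs
import Mathlib.NumberTheory.Cyclotomic.Basic
import HarnessLib

/-!
# FACT-LIST row F-0066 `AddLineBundleAutIsRootOfUnity` ([AbsTopIII] Def 5.3 (iii)) — INSTANCE FORMS at genuine number fields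

S. Mochizuki, *Topics in Absolute Anabelian Geometry III*, J. Math. Sci. Univ. Tokyo 22 (2015) [MochizukiAbsTopIII2015],
Definition 5.3 (iii), kurims manuscript p. 124 (`paper:url-5493eb38cbb7`): «the automorphism group of any object of
`Th⊚⊡_T[M⊚]` is naturally isomorphic to the finite abelian group `μ`» — typed (abc-iut-L4 lineage) as the schema
`AddLineBundleAutIsRootOfUnity (F) [Field F] : Prop`: every automorphism of a `⊞`-line bundle over `𝒪_F` is
multiplication by a root of unity of `F`.

PROOF-ONLY companion (no `def`, nothing restated).  Kernel status of the row before this file: universal closure over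
ALL fields REFUTED (`not_forall_addLineBundleAutIsRootOfUnity`: a field containing `ℝ`), universal closer for NUMBER
FIELDS proved (`AddLineBundleAutIsRootOfUnity_holds`, Kronecker's theorem).  This file records the ZERO-BINDER
INSTANCE FORMS the census asks for, at GENUINE carriers produced by Mathlib: the rational field `ℚ` and the cyclotomic
field `ℚ(ζ₃)` (`CyclotomicField 3 ℚ`), plus the instance at every cyclotomic field `ℚ(ζₙ)`.  All three are
one-line specialisations of the number-field closer; they are stated so that the conclusion HEAD is the row's
declaration with no hypothesis left.

HONEST FRAMING: refereed pre-IUT material; an instance-form theorem about OUR typed statement, not a theorem about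
IUT in print; nothing here bears on [IUTchIII] Cor. 3.12; no side taken; typed ≠ proved.
-/

namespace Literature.AnabelianGeometry.AbsoluteAnabelian

/-- **F-0066, INSTANCE FORM at `F = ℚ`** (zero binders): every automorphism of a `⊞`-line bundle over `ℤ = 𝒪_ℚ` is
multiplication by a root of unity (`±1`) — [AbsTopIII] Def 5.3 (iii) p. 124 at the genuine carrier `ℚ`, by the
number-field closer `AddLineBundleAutIsRootOfUnity_holds`. [cite: MochizukiAbsTopIII2015, Def 5.3 (iii) p.124] -/
theorem addLineBundleAutIsRootOfUnity_rat :
    Literature.AnabelianGeometry.AbsoluteAnabelian.AddLineBundleAutIsRootOfUnity ℚ :=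
  AddLineBundleAutIsRootOfUnity_holds ℚ

/-- **F-0066, INSTANCE FORM at the cyclotomic field `ℚ(ζ₃)`** (zero binders; Mathlib's `CyclotomicField 3 ℚ`, a
number field by `IsCyclotomicExtension.numberField`): automorphisms of `⊞`-line bundles over `ℤ[ζ₃]` are roots of
unity. [cite: MochizukiAbsTopIII2015, Def 5.3 (iii) p.124] -/
theorem addLineBundleAutIsRootOfUnity_cyclotomicField_three :
    Literature.AnabelianGeometry.AbsoluteAnabelian.AddLineBundleAutIsRootOfUnity (CyclotomicField 3 ℚ) :=
  AddLineBundleAutIsRootOfUnity_holds (CyclotomicField 3 ℚ)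

/-- **F-0066, INSTANCE FORM at every cyclotomic field `ℚ(ζₙ)`** (one binder `n : ℕ`, an inhabited type; no
hypothesis): [AbsTopIII] Def 5.3 (iii) p. 124 at `CyclotomicField n ℚ`. [cite: MochizukiAbsTopIII2015, Def 5.3 (iii) p.124] -/
theorem addLineBundleAutIsRootOfUnity_cyclotomicField (n : ℕ) :
    Literature.AnabelianGeometry.AbsoluteAnabelian.AddLineBundleAutIsRootOfUnity (CyclotomicField n ℚ) :=
  AddLineBundleAutIsRootOfUnity_holds (CyclotomicField n ℚ)

end Literature.AnabelianGeometry.AbsoluteAnabelian
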